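import Mathlib
import Summits.Ventures.PercRepro2.PMK5Typed
import Summits.Ventures.PercRepro2.PMK5Strict
import Summits.Ventures.PercRepro2.PMK5Locus
import Summits.Ventures.PercRepro2.PMK5LocusFace
import Summits.Ventures.PercRepro2.PMK5LocusZero
import Summits.Ventures.PercRepro2.PMK5LocusH

/-!
# THE EQUALITY LOCUS OF `(HALF-PM⁺)_H` ON FIVE-VERTEX BASES — THE ZERO SIDE AND THE TWO «IFF»s
(blind cell PercRepro2, mine-2 g23; the `H`-companion of `PMK5LocusZero.lean`; on `PMK5LocusH.lean` (the
positive side, `RuleH`) and `PMK5LocusFace.lean` (restricted tables and their Kronecker numbers); row 2′BETA1)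

The `H`-degenerate edge sets (`RuleH`, the exact zero set of the class sums of `(HALF-PM⁺)_H`) form a down-set
with 5 maximal elements `MxH` (`coverZH`, one `decide +kernel`); on each of them the positive and the negative
restricted Kronecker numbers are EQUAL (`faceH_*`, 5 `decide +kernel`), so every coefficient supported inside a
degenerate face vanishes (`coefH_eq_of_face`), whence `halfH_K5_zero_of_face`, and the two «iff»s
`halfH_K5_pos_iff` / `halfH_K5_zero_iff` (the centre of the face separates the cases).  Standard axioms.
-/

namespace Summit.Ventures.PercRepro2

open Hub

namespace K5

namespace PM

/-! ## The 5 maximal `H`-degenerate faces (kernel) -/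

set_option maxRecDepth 100000 in
/-- The restricted numbers of `(HALF-PM⁺)_H` agree on the face `249` = {01 04 12 13 14 23}. -/
theorem faceH_249 : kPosHm 249 = kNegHm 249 := by
  decide +kernel

set_option maxRecDepth 100000 in
/-- The restricted numbers of `(HALF-PM⁺)_H` agree on the face `503` = {01 02 03 12 13 14 23 24}. -/
theorem faceH_503 : kPosHm 503 = kNegHm 503 := by
  decide +kernel

set_option maxRecDepth 100000 in
/-- The restricted numbers of `(HALF-PM⁺)_H` agree on the face `637` = {01 03 04 12 13 14 34}. -/
theorem faceH_637 : kPosHm 637 = kNegHm 637 := by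
  decide +kernel

set_option maxRecDepth 100000 in
/-- The restricted numbers of `(HALF-PM⁺)_H` agree on the face `926` = {02 03 04 12 23 24 34}. -/
theorem faceH_926 : kPosHm 926 = kNegHm 926 := by
  decide +kernel

set_option maxRecDepth 100000 in
/-- The restricted numbers of `(HALF-PM⁺)_H` agree on the face `1011` = {01 02 12 13 14 23 24 34}. -/
theorem faceH_1011 : kPosHm 1011 = kNegHm 1011 := by
  decide +kernel

/-- **Every coefficient of `(HALF-PM⁺)_H` supported inside a face with equal restricted numbers vanishes.** -/
theorem coefH_eq_of_face (m : ℕ) (hz : kPosHm m = kNegHm m) (k : Fin 10 → Fin 4)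
    (hk : ∀ e : Fin 10, k e ≠ 0 → m.testBit e = true) : cntPosH k = cntNegH k := by
  have h := eq_of_kron_eq _ _ (cntPosHm_lt m) (cntNegHm_lt m) (kPosHm_eq m) (kNegHm_eq m) hz k
  unfold cntPosHm cntNegHm at h
  simp only [cnt3_restr_eq hk] at h
  unfold cntPosH cntNegH
  omega

/-- The 5 maximal `H`-degenerate edge sets. -/
def MxH : Fin 5 → ℕ := ![249, 503, 637, 926, 1011]

set_option maxRecDepth 100000 in
/-- **Every `H`-degenerate edge set lies inside one of the maximal ones.** -/
theorem coverZH : ∀ m : Fin 1024, RuleH m = true →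
    ∃ i : Fin 5, ∀ e : Fin 10, (m : ℕ).testBit e = true → (MxH i).testBit e = true := by
  decide +kernel

/-- The restricted numbers agree on each maximal `H`-degenerate face. -/
theorem faceH_all : ∀ i : Fin 5, kPosHm (MxH i) = kNegHm (MxH i) := by
  intro i
  fin_cases i
  exacts [faceH_249, faceH_503, faceH_637, faceH_926, faceH_1011]

section Face

variable {R : Type*} [Field R] [LinearOrder R] [IsStrictOrderedRing R]

omit [LinearOrder R] [IsStrictOrderedRing R] in
/-- **THE EQUALITY LOCUS OF `(HALF-PM⁺)_H` — THE ZERO SIDE**: on every `H`-degenerate edge set `m` the cleared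
`(HALF-PM⁺)_H` vanishes at every weight vector supported on `m`. -/
theorem halfH_K5_zero_of_face (m : ℕ) (hm : m < 1024) (hr : RuleH m = true) (p : Fin 10 → R)
    (hp₀ : ∀ e : Fin 10, m.testBit e = false → p e = 0) :
    
    prob p (connEvent ends5 1 2)ᶜ *
          (prob p (connEvent ends5 1 2)ᶜ *
              prob p (connEvent ends5 2 4 ∩ connEvent ends5 1 3 ∩
                (connEvent ends5 1 0 ∪ connEvent ends5 2 0) ∩ (connEvent ends5 1 2)ᶜ) -
            prob p (connEvent ends5 2 4 ∩ (connEvent ends5 1 2)ᶜ) *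
              prob p (connEvent ends5 1 3 ∩ (connEvent ends5 1 0 ∪ connEvent ends5 2 0) ∩
                (connEvent ends5 1 2)ᶜ)) -
        prob p ((connEvent ends5 1 0 ∪ connEvent ends5 2 0) ∩ (connEvent ends5 1 2)ᶜ) *
          (prob p (connEvent ends5 1 2)ᶜ *
              prob p (connEvent ends5 2 4 ∩ connEvent ends5 1 3 ∩ (connEvent ends5 1 2)ᶜ) -
            prob p (connEvent ends5 2 4 ∩ (connEvent ends5 1 2)ᶜ) *
              prob p (connEvent ends5 1 3 ∩ (connEvent ends5 1 2)ᶜ)) -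
        prob p (connEvent ends5 1 2)ᶜ *
          (prob p (connEvent ends5 1 2)ᶜ *
              prob p (connEvent ends5 2 4 ∩ connEvent ends5 1 0 ∩ (connEvent ends5 1 2)ᶜ) -
            prob p (connEvent ends5 2 4 ∩ (connEvent ends5 1 2)ᶜ) *
              prob p (connEvent ends5 1 0 ∩ (connEvent ends5 1 2)ᶜ)) = 0 := by
  rw [halfH_eq_bern]
  refine Finset.sum_eq_zero fun k _ => ?_
  by_cases hk : ∀ e : Fin 10, k e ≠ 0 → m.testBit e = true
  · obtain ⟨i, hi⟩ := coverZH ⟨m, hm⟩ hr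
    have hc := coefH_eq_of_face (MxH i) (faceH_all i) k fun e he => hi e (hk e he)
    rw [hc, sub_self, mul_zero]
  · obtain ⟨e, he⟩ := not_forall.1 hk
    obtain ⟨hke, hme⟩ := Classical.not_imp.1 he
    have hpe : p e = 0 := hp₀ e (by simpa using hme)
    have hb : bern p k = 0 := by
      unfold bern
      apply Finset.prod_eq_zero (Finset.mem_univ e)
      rw [hpe, zero_pow (fun h => hke (Fin.ext (by simpa using h)))]
      simp
    rw [hb, zero_mul]

/-- **THE EQUALITY LOCUS OF `(HALF-PM⁺)_H`, FIRST «IFF»**: strictly positive on the whole open face ⟺ not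
`H`-degenerate. -/
theorem halfH_K5_pos_iff (m : ℕ) (hm : m < 1024) :
    (∀ p : Fin 10 → R, (∀ e : Fin 10, m.testBit e = true → 0 < p e ∧ p e < 1) →
      (∀ e : Fin 10, m.testBit e = false → p e = 0) →
      0 < 
    prob p (connEvent ends5 1 2)ᶜ *
          (prob p (connEvent ends5 1 2)ᶜ *
              prob p (connEvent ends5 2 4 ∩ connEvent ends5 1 3 ∩
                (connEvent ends5 1 0 ∪ connEvent ends5 2 0) ∩ (connEvent ends5 1 2)ᶜ) -
            prob p (connEvent ends5 2 4 ∩ (connEvent ends5 1 2)ᶜ) *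
              prob p (connEvent ends5 1 3 ∩ (connEvent ends5 1 0 ∪ connEvent ends5 2 0) ∩
                (connEvent ends5 1 2)ᶜ)) -
        prob p ((connEvent ends5 1 0 ∪ connEvent ends5 2 0) ∩ (connEvent ends5 1 2)ᶜ) *
          (prob p (connEvent ends5 1 2)ᶜ *
              prob p (connEvent ends5 2 4 ∩ connEvent ends5 1 3 ∩ (connEvent ends5 1 2)ᶜ) -
            prob p (connEvent ends5 2 4 ∩ (connEvent ends5 1 2)ᶜ) *
              prob p (connEvent ends5 1 3 ∩ (connEvent ends5 1 2)ᶜ)) -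
        prob p (connEvent ends5 1 2)ᶜ *
          (prob p (connEvent ends5 1 2)ᶜ *
              prob p (connEvent ends5 2 4 ∩ connEvent ends5 1 0 ∩ (connEvent ends5 1 2)ᶜ) -
            prob p (connEvent ends5 2 4 ∩ (connEvent ends5 1 2)ᶜ) *
              prob p (connEvent ends5 1 0 ∩ (connEvent ends5 1 2)ᶜ))) ↔ RuleH m = false := by
  constructor
  · intro h
    rcases Bool.eq_false_or_eq_true (RuleH m) with hr | hr
    · exfalso
      have hpos := h (centre (R := R) m) (fun e he => centre_on_pos he) (fun e he => centre_off he)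
      have hzero := halfH_K5_zero_of_face m hm hr (centre (R := R) m) (fun e he => centre_off he)
      rw [hzero] at hpos
      exact lt_irrefl _ hpos
    · exact hr
  · intro hr p hp₁ hp₀
    exact halfH_K5_pos_of_face m hm hr p hp₁ hp₀

/-- **THE EQUALITY LOCUS OF `(HALF-PM⁺)_H`, SECOND «IFF»**: identically zero on the face ⟺ `H`-degenerate. -/
theorem halfH_K5_zero_iff (m : ℕ) (hm : m < 1024) :
    (∀ p : Fin 10 → R, (∀ e : Fin 10, 0 ≤ p e ∧ p e ≤ 1) →
      (∀ e : Fin 10, m.testBit e = false → p e = 0) →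
      
    prob p (connEvent ends5 1 2)ᶜ *
          (prob p (connEvent ends5 1 2)ᶜ *
              prob p (connEvent ends5 2 4 ∩ connEvent ends5 1 3 ∩
                (connEvent ends5 1 0 ∪ connEvent ends5 2 0) ∩ (connEvent ends5 1 2)ᶜ) -
            prob p (connEvent ends5 2 4 ∩ (connEvent ends5 1 2)ᶜ) *
              prob p (connEvent ends5 1 3 ∩ (connEvent ends5 1 0 ∪ connEvent ends5 2 0) ∩
                (connEvent ends5 1 2)ᶜ)) -
        prob p ((connEvent ends5 1 0 ∪ connEvent ends5 2 0) ∩ (connEvent ends5 1 2)ᶜ) *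
          (prob p (connEvent ends5 1 2)ᶜ *
              prob p (connEvent ends5 2 4 ∩ connEvent ends5 1 3 ∩ (connEvent ends5 1 2)ᶜ) -
            prob p (connEvent ends5 2 4 ∩ (connEvent ends5 1 2)ᶜ) *
              prob p (connEvent ends5 1 3 ∩ (connEvent ends5 1 2)ᶜ)) -
        prob p (connEvent ends5 1 2)ᶜ *
          (prob p (connEvent ends5 1 2)ᶜ *
              prob p (connEvent ends5 2 4 ∩ connEvent ends5 1 0 ∩ (connEvent ends5 1 2)ᶜ) -
            prob p (connEvent ends5 2 4 ∩ (connEvent ends5 1 2)ᶜ) *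
              prob p (connEvent ends5 1 0 ∩ (connEvent ends5 1 2)ᶜ)) = 0) ↔ RuleH m = true := by
  constructor
  · intro h
    rcases Bool.eq_false_or_eq_true (RuleH m) with hr | hr
    · exact hr
    · exfalso
      have hpos := halfH_K5_pos_of_face m hm hr (centre (R := R) m)
        (fun e he => centre_on_pos he) (fun e he => centre_off he)
      have hzero := h (centre (R := R) m) (centre_01 m) (fun e he => centre_off he)
      rw [hzero] at hpos
      exact lt_irrefl _ hpos
  · intro hr p _ hp₀
    exact halfH_K5_zero_of_face m hm hr p hp₀

end Face

end PM

end K5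

end Summit.Ventures.PercRepro2
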